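import Summits.CriticalPhenomena.CardyFormulaZ2.Theorems.CardyMagicRigidityMarkovCascadeDefs
import Summits.CriticalPhenomena.CardyFormulaZ2.Theorems.CardyMagicRigidityNestingRigidityOneGenerationZ2Interiors
import Literature.Probability.Percolation.InterfaceLoopSeparation
import HarnessLib

/-!
# The outermost loops of the closed-b.c. `ℤ²` domain ensemble are of type `1`

Crux `Summit.CriticalPhenomena.CardyFormulaZ2.Theses.CardyMagicRigidity.NestingRigidity`
(stmt-CriticalPhenomena-4835), line `markov-cascade-one-generation`, registered helper
`firstGen_domLoopsZ2_F_zero` (wave 2) toward the stubs `stub_kernelUniqueness` /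
`stub_cascadeReconstruction`: **no type-`0` loop of the closed-boundary-condition domain ensemble
`domLoopsZ2 U δ ω` is outermost**, i.e. `(firstGen (domLoopsZ2 U δ ω)).F 0 = ∅` for bounded `U` and
`δ > 0`.

Write `β = ω ∩ meshEdges U δ` (finitely many open lattice edges, all with both endpoints among the
finitely many mesh vertices of `U`) and `W_γ = (loopCurve 1 0 γ).wind`.  Let `γ` be a type-`0`
interface loop of `β` and `p` one of its darts with an OPEN target edge (one exists: a loop all of
whose target edges are closed turns around a single vertex — its darts are the four corners there —
and such a "diamond" winds around no face centre, whereas a type-`0` loop has `W = -1` on the faces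
of its darts).  Then `W_γ(p.1) = 0` and `W_γ(face of p) = -1`.  Run the lattice path
`p.1, p.1 + e₀, …, p.1 + m e₀` eastwards, far enough that the face east of its end lies outside the
ball `B(0, ρ + 1/2)` containing the trace of every interface loop of `β` with an open edge (their
rims are joined by open edges to a mesh vertex of `U`, and traces are within `1/2` of rims).  Every
corner is periodic for the turning rule of `β` (orbits stay over finitely many vertices), so the
counting lemma `exists_orbitLoop_wind_ne_of_path` produces an interface loop `L = orbitLoop β q`
through a path vertex with `W_L(p.1) ≠ W_L(far face)`.  `L` is not a diamond (a diamond around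
`p.1` shares the dart `p` with `γ`, hence has the same windings, `W(p.1) = 0 = W(far face)`; a
diamond elsewhere winds around neither point), so `L` has an open edge, `W_L(far face) = 0` and
`W_L(p.1) ≠ 0`; it shares no dart with `γ`, so `W_L(face of p) = W_L(p.1) ≠ 0`.  In the cell
trichotomy (`interfaceLoop_cells_nested_or_disjoint`) for `γ, L` this excludes "`L` inside `γ`"
(at `p.1`) and "disjoint" (at the face of `p`): the winding interior of `γ` is inside that of `L`,
strictly (the point `p.1`).  Rescaling to mesh `δ` and reading the open target edge of `L` as an
edge of `meshEdges U δ` visited by `L`, the drawn loop of `L` is a loop of `domLoopsZ2 U δ ω` whose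
interior strictly contains that of the drawn `γ`: `γ` is not first generation.
-/

noncomputable section

open Set Function Metric

namespace Summit.CriticalPhenomena.CardyFormulaZ2.Cruxes.NestingRigidity.MarkovCascadeOneGeneration

open Literature.Probability.RandomPlanarGeometry Literature.Probability.Percolation
  Literature.Probability.LatticeModels

variable {β : BondConfig (Site 2)} {L γ : List MedialVertex}

/-! ## Configurations whose open edges live on a finite vertex set -/

/-- If every open edge `s(x, y) ∈ β` has its endpoints in the finite set `S`, the orbit of a corner
`c` under the turning rule of `β` stays over the vertices `insert c.1 S`, so every corner is a
periodic point of `nextCorner β`. -/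
theorem mem_periodicPts_nextCorner_of_subset {S : Set (Site 2)} (hS : S.Finite)
    (hβ : ∀ x y, s(x, y) ∈ β → x ∈ S ∧ y ∈ S) (c : Site 2 × Fin 4) :
    c ∈ periodicPts (nextCorner β) := by
  refine mem_periodicPts_nextCorner_of_finite (S := (insert c.1 S) ×ˢ (univ : Set (Fin 4)))
    ((hS.insert c.1).prod finite_univ) fun m ↦ ⟨?_, mem_univ _⟩
  induction m with
  | zero => exact mem_insert _ _
  | succ m ih =>
    rw [iterate_succ_apply']
    by_cases h : cTgt ((nextCorner β)^[m] c) ∈ β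
    · rw [nextCorner_of_mem h]
      exact mem_insert_of_mem _ (hβ _ _ h).2
    · rw [nextCorner_of_not_mem h]
      exact ih

/-- The far end of a walk of open lattice edges starting in `S` lies in `S`. -/
theorem mem_of_walk {S : Set (Site 2)} (hβ : ∀ x y, s(x, y) ∈ β → x ∈ S ∧ y ∈ S) {a b : Site 2}
    (w : (openGraph β ⊓ zdGraph 2).Walk a b) (ha : a ∈ S) : b ∈ S := by
  induction w with
  | nil => exact ha
  | cons hadj _ ih =>
    rw [SimpleGraph.inf_adj, openGraph_adj] at hadj
    exact ih (hβ _ _ hadj.1.1).2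

/-! ## Loops without an open edge are diamonds around one vertex -/

/-- **All-closed loops turn around one vertex.** If no dart of the interface loop `L` has an open
target edge, the darts of `L` are exactly the four corners at the left vertex of any given dart
`q₀` of `L` (the successor of a corner with a closed target edge is the next corner around the same
vertex). -/
theorem dart_mem_iff_fst_eq_of_forall_not_mem (hL : IsInterfaceLoop β L) {q₀ : Site 2 × Fin 4}
    (hq₀ : (cSrc q₀, cTgt q₀) ∈ L.zip (L.rotate 1))
    (hB : ∀ q : Site 2 × Fin 4, (cSrc q, cTgt q) ∈ L.zip (L.rotate 1) → cTgt q ∉ β)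
    (q : Site 2 × Fin 4) : (cSrc q, cTgt q) ∈ L.zip (L.rotate 1) ↔ q.1 = q₀.1 := by
  constructor
  · -- the orbit of `q₀` keeps the vertex `q₀.1`
    have hfst : ∀ k : ℕ, ((nextCorner β)^[k] q₀).1 = q₀.1 := by
      intro k
      induction k with
      | zero => rfl
      | succ k ih =>
        have hk : (cSrc ((nextCorner β)^[k] q₀), cTgt ((nextCorner β)^[k] q₀)) ∈
            L.zip (L.rotate 1) := (hL.mem_zip_iterate_iff q₀ k).2 hq₀
        rw [iterate_succ_apply', nextCorner_of_not_mem (hB _ hk)]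
        exact ih
    intro hq
    obtain ⟨k, rfl⟩ := hL.exists_eq_iterate hq₀ hq
    exact hfst k
  · -- the four corners at `q₀.1` are the first four corners of the orbit
    have hsucc : ∀ c : Site 2 × Fin 4, (cSrc c, cTgt c) ∈ L.zip (L.rotate 1) →
        (cSrc (c.1, c.2 + 1), cTgt (c.1, c.2 + 1)) ∈ L.zip (L.rotate 1) := fun c hc ↦ by
      have := hL.mem_zip_nextCorner hc
      rwa [nextCorner_of_not_mem (hB c hc)] at this
    have h1 := hsucc _ hq₀
    have h2 := hsucc _ h1
    have h3 := hsucc _ h2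
    have hfin : ∀ a b : Fin 4, b = a ∨ b = a + 1 ∨ b = a + 1 + 1 ∨ b = a + 1 + 1 + 1 := by decide
    intro hq
    obtain ⟨x, k⟩ := q
    dsimp only at hq
    subst hq
    rcases hfin q₀.2 k with rfl | rfl | rfl | rfl
    · exact hq₀
    · exact h1
    · exact h2
    · exact h3

/-- **A diamond winds around its vertex only.** If the darts of the interface loop `L` are exactly
the four corners at `w`, then `L` winds around no face centre and around no lattice point other
than `w`: off `w` the winding number does not jump across corners, so along the eastward ray from
`w` the face windings are constant, hence zero (far lattice points are not wound around); then
`W(w) = 1` by the jump across the corner `(w, 0)`, the four faces at `w` have `W = W(w) - 1 = 0`,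
and ray propagation (`cells_empty_of_corner_iff`) empties `{W ≠ 0}` off `w`. -/
theorem wind_eq_zero_of_dart_iff_fst_eq (hL : IsInterfaceLoop β L) {w : Site 2}
    (hw : ∀ q : Site 2 × Fin 4, (cSrc q, cTgt q) ∈ L.zip (L.rotate 1) ↔ q.1 = w) :
    (∀ f : Site 2, (loopCurve 1 0 L).wind (faceCenter f) = 0) ∧
      ∀ x : Site 2, x ≠ w → (loopCurve 1 0 L).wind (meshPoint 1 x) = 0 := by
  -- off `w` nothing jumps; at `w` every corner jumps
  have hoff : ∀ (x : Site 2) (k : Fin 4), x ≠ w →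
      (loopCurve 1 0 L).wind (meshPoint 1 x) = (loopCurve 1 0 L).wind (faceCenter (cFace (x, k))) :=
    fun x k hx ↦ wind_fst_eq_wind_cFace hL (p := (x, k)) fun h ↦ hx ((hw (x, k)).1 h)
  have hon : ∀ k : Fin 4, (loopCurve 1 0 L).wind (meshPoint 1 w) =
      (loopCurve 1 0 L).wind (faceCenter (cFace (w, k))) + 1 := by
    intro k
    have := hL.wind_sub_wind_cFace (w, k)
    rw [if_pos ((hw (w, k)).2 rfl)] at this
    dsimp only at this
    omega
  have hne : ∀ n : ℕ, w + Pi.single 0 (n : ℤ) + Pi.single 0 1 ≠ w := by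
    intro n h
    have := congrFun h 0
    simp only [Pi.add_apply, Pi.single_eq_same] at this
    omega
  -- along the eastward ray from `w` the face windings are constant
  have hray : ∀ n : ℕ, (loopCurve 1 0 L).wind (faceCenter (w + Pi.single 0 (n : ℤ))) =
      (loopCurve 1 0 L).wind (faceCenter w) := by
    intro n
    induction n with
    | zero => simp
    | succ n ih =>
      have h0 := hoff _ 0 (hne n)
      have h1 := hoff _ 1 (hne n)
      rw [cFace_vertex_zero] at h0
      rw [cFace_add_single_zero_one] at h1
      rw [Nat.cast_succ, Pi.single_add, ← add_assoc, ← h0, h1, ih]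
  have hray' : ∀ n : ℕ,
      (loopCurve 1 0 L).wind (faceCenter (w + Pi.single 0 (n : ℤ) + Pi.single 0 1)) =
        (loopCurve 1 0 L).wind (faceCenter w) := by
    intro n
    have := hray (n + 1)
    rwa [Nat.cast_succ, Pi.single_add, ← add_assoc] at this
  -- far out the lattice points of the ray are not wound around: neither is the face `w`
  have hF0 : (loopCurve 1 0 L).wind (faceCenter w) = 0 := by
    obtain ⟨N, hN⟩ := exists_wind_ray_eq_zero L w
    have h := hN (N + 1) (Nat.le_succ N)
    have h0 := hoff _ 0 (hne N)
    rw [cFace_vertex_zero] at h0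
    rw [Nat.cast_succ, Pi.single_add, ← add_assoc, h0, hray' N] at h
    exact h
  -- hence `W(w) = 1` and the four faces at `w` are not wound around
  have hw1 : (loopCurve 1 0 L).wind (meshPoint 1 w) = 1 := by
    have := hon 0
    rw [cFace_vertex_zero, hF0] at this
    omega
  have hfk : ∀ k : Fin 4, (loopCurve 1 0 L).wind (faceCenter (cFace (w, k))) = 0 := by
    intro k
    have := hon k
    omega
  -- propagate
  have key := cells_empty_of_corner_iff
    (SV := fun x ↦ x ≠ w ∧ (loopCurve 1 0 L).wind (meshPoint 1 x) ≠ 0)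
    (SF := fun f ↦ (loopCurve 1 0 L).wind (faceCenter f) ≠ 0) ?_ ?_
  · exact ⟨fun f ↦ not_ne_iff.1 (key.2 f), fun x hx ↦ not_ne_iff.1 fun h ↦ key.1 x ⟨hx, h⟩⟩
  · rintro ⟨x, k⟩
    dsimp only
    by_cases hx : x = w
    · rw [hx, hfk k]
      simp
    · rw [hoff x k hx]
      exact ⟨fun h ↦ h.2, fun h ↦ ⟨hx, h⟩⟩
  · intro v
    obtain ⟨N, hN⟩ := exists_wind_ray_eq_zero L v
    exact ⟨N, fun h ↦ h.2 (hN N le_rfl)⟩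

/-! ## Loops with an open edge stay near the open edges -/

/-- **Localisation of a loop with an open edge.** If every open edge of `β` has its endpoints in
`S`, all drawn inside `B(0, ρ)` at mesh `1`, then an interface loop of `β` one of whose darts has an
OPEN target edge has its trace inside `B(0, ρ + 1/2)`: its rim is joined to that dart's vertex by
open lattice edges (`IsInterfaceLoop.reachable_left`), and the trace is within `1/2` of the rim
(`IsInterfaceLoop.exists_left_dist_le`). -/
theorem range_subset_ball_of_cTgt_mem (hL : IsInterfaceLoop β L) {S : Set (Site 2)} {ρ : ℝ}
    (hβ : ∀ x y, s(x, y) ∈ β → x ∈ S ∧ y ∈ S) (hρ : ∀ x ∈ S, ‖meshPoint 1 x‖ < ρ)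
    {q₀ : Site 2 × Fin 4} (hq₀ : (cSrc q₀, cTgt q₀) ∈ L.zip (L.rotate 1)) (ho : cTgt q₀ ∈ β) :
    (loopCurve 1 0 L).range ⊆ ball 0 (ρ + 1 / 2) := by
  have hq₀S : q₀.1 ∈ S := (hβ _ _ ho).1
  intro x hx
  obtain ⟨q, hq, hdist⟩ := hL.exists_left_dist_le hx
  obtain ⟨p⟩ := hL.reachable_left hq₀ hq
  have h1 := hρ _ (mem_of_walk hβ p hq₀S)
  have h2 := norm_sub_norm_le x (meshPoint 1 q.1)
  rw [← dist_eq_norm] at h2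
  rw [mem_ball, dist_zero_right]
  linarith

/-- Far east of a vertex drawn inside `B(0, ρ)`, the face with lower-left corner
`v₀ + ⌈2ρ⌉₊ e₀` has its centre outside `B(0, ρ + 1/2)`. -/
theorem le_norm_faceCenter_far {v₀ : Site 2} {ρ : ℝ} (hv₀ : ‖meshPoint 1 v₀‖ < ρ) :
    ρ + 1 / 2 ≤ ‖faceCenter (v₀ + Pi.single 0 (⌈2 * ρ⌉₊ : ℤ))‖ := by
  have hre : |(meshPoint 1 v₀).re| < ρ := (Complex.abs_re_le_norm _).trans_lt hv₀
  rw [meshPoint_re, one_mul] at hre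
  have hm : 2 * ρ ≤ (⌈2 * ρ⌉₊ : ℝ) := Nat.le_ceil _
  refine le_trans ?_ (Complex.re_le_norm _)
  rw [faceCenter_re]
  simp only [Pi.add_apply, Pi.single_eq_same, Int.cast_add, Int.cast_natCast]
  have := (abs_lt.1 hre).1
  linarith

/-! ## A type-`0` loop is strictly enclosed by a loop with an open edge -/

/-- **A type-`0` interface loop is strictly enclosed by another interface loop of the same
configuration, which has an open edge**, provided the open edges live on a finite set of vertices
(closed boundary condition outside a bounded domain).  See the module docstring for the proof. -/
theorem exists_ssubset_of_loopType_eq_zero {S : Set (Site 2)} (hS : S.Finite)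
    (hβ : ∀ x y, s(x, y) ∈ β → x ∈ S ∧ y ∈ S) (hγ : IsInterfaceLoop β γ) (ht : loopType γ = 0) :
    ∃ L : List MedialVertex, IsInterfaceLoop β L ∧
      (∃ q : Site 2 × Fin 4, (cSrc q, cTgt q) ∈ L.zip (L.rotate 1) ∧ cTgt q ∈ β) ∧
      {z | (loopCurve 1 0 γ).wind z ≠ 0} ⊂ {z | (loopCurve 1 0 L).wind z ≠ 0} := by
  -- the vertices of the open edges, drawn at mesh `1`, lie in a ball `B(0, ρ)`
  obtain ⟨ρ, hρ⟩ := (hS.image (meshPoint 1)).isBounded.subset_ball 0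
  have hρ' : ∀ x ∈ S, ‖meshPoint 1 x‖ < ρ := fun x hx ↦ by
    simpa using hρ (mem_image_of_mem _ hx)
  -- a dart `p` of `γ` with an open target edge (else `γ` is a diamond, winding around no face)
  obtain ⟨p₀, hs₀, ht₀⟩ := hγ.exists_corner 0
  have hp₀ : (cSrc p₀, cTgt p₀) ∈ γ.zip (γ.rotate 1) := by
    rw [hs₀, ht₀]
    exact hγ.getElem_mod_mem_zip 0
  obtain ⟨p, hp, hpo⟩ : ∃ p : Site 2 × Fin 4,
      (cSrc p, cTgt p) ∈ γ.zip (γ.rotate 1) ∧ cTgt p ∈ β := by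
    by_contra hcon
    push Not at hcon
    have h0 := (wind_eq_zero_of_dart_iff_fst_eq hγ
      (dart_mem_iff_fst_eq_of_forall_not_mem hγ hp₀ hcon)).1 (cFace p₀)
    have h1 := hγ.wind_cFace_eq_neg_one ht hp₀
    omega
  have hγv : (loopCurve 1 0 γ).wind (meshPoint 1 p.1) = 0 := hγ.wind_left_eq_zero ht hp
  have hγf : (loopCurve 1 0 γ).wind (faceCenter (cFace p)) = -1 := hγ.wind_cFace_eq_neg_one ht hp
  have hpS : p.1 ∈ S := (hβ _ _ hpo).1
  -- the eastward path from `p.1`, long enough to end east of `B(0, ρ + 1/2)`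
  set m : ℕ := ⌈2 * ρ⌉₊ with hm
  let v : ℕ → Site 2 := fun j ↦ p.1 + Pi.single 0 (j : ℤ)
  have hstep : ∀ j < m, v (j + 1) = v j + cornerUnit 0 := by
    intro j _
    simp only [v, Nat.cast_succ, Pi.single_add, add_assoc, cornerUnit]
  have hper : ∀ j ≤ m, ∀ k' : Fin 4, (v j, k') ∈ periodicPts (nextCorner β) :=
    fun j _ k' ↦ mem_periodicPts_nextCorner_of_subset hS hβ _
  obtain ⟨q, -, hq, hne⟩ := exists_orbitLoop_wind_ne_of_path (d := fun _ ↦ 0) hstep 0 hper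
  have hv0 : v 0 = p.1 := by simp [v]
  have hvm : faceAt (v m) 0 = p.1 + Pi.single 0 (m : ℤ) := cFace_vertex_zero _
  rw [hv0, hvm] at hne
  set L := orbitLoop β q with hLdef
  have hL : IsInterfaceLoop β L := isInterfaceLoop_orbitLoop hq
  have hqL : (cSrc q, cTgt q) ∈ L.zip (L.rotate 1) := (mem_darts_orbitLoop_iff hq).2 ⟨0, rfl⟩
  -- a dart shared with `γ` would give `L` the windings of `γ`, in particular `W_L(p.1) = 0`
  have hshare : ∀ p' : Site 2 × Fin 4, (cSrc p', cTgt p') ∈ L.zip (L.rotate 1) →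
      (cSrc p', cTgt p') ∈ γ.zip (γ.rotate 1) → (loopCurve 1 0 L).wind (meshPoint 1 p.1) = 0 :=
    fun p' h₁ h₂ ↦ by
      rw [(wind_cells_eq_of_dart_iff hL hγ (dart_iff_of_shared hL hγ h₁ h₂)).1, hγv]
  -- `L` has a dart with an open target edge (else it is a diamond: around `p.1` it shares the dart
  -- `p` with `γ`, elsewhere it winds neither around `p.1` nor around the far face)
  obtain ⟨q', hq', hq'o⟩ : ∃ q' : Site 2 × Fin 4,
      (cSrc q', cTgt q') ∈ L.zip (L.rotate 1) ∧ cTgt q' ∈ β := by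
    by_contra hcon
    push Not at hcon
    have hw := dart_mem_iff_fst_eq_of_forall_not_mem hL hqL hcon
    obtain ⟨hF0, hV0⟩ := wind_eq_zero_of_dart_iff_fst_eq hL hw
    rw [hF0] at hne
    by_cases hpq : p.1 = q.1
    · exact hne (hshare p ((hw p).2 hpq) hp)
    · exact hne (hV0 _ hpq)
  -- the far face is not wound around by `L`, hence `p.1` is
  have hfar : (loopCurve 1 0 L).wind (faceCenter (p.1 + Pi.single 0 (m : ℤ))) = 0 :=
    (loopCurve 1 0 L).wind_eq_zero_of_subset_ball
      (range_subset_ball_of_cTgt_mem hL hβ hρ' hq' hq'o)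
      (by rw [dist_zero_right, hm]; exact le_norm_faceCenter_far (hρ' _ hpS))
  rw [hfar] at hne
  -- so `p` is not a dart of `L`, and the face of `p` is wound around by `L` as `p.1` is
  have hpL : (cSrc p, cTgt p) ∉ L.zip (L.rotate 1) := fun h ↦ hne (hshare p h hp)
  have hfL : (loopCurve 1 0 L).wind (faceCenter (cFace p)) ≠ 0 := by
    rwa [← wind_fst_eq_wind_cFace hL hpL]
  refine ⟨L, hL, ⟨q', hq', hq'o⟩, ?_⟩
  rcases interfaceLoop_cells_nested_or_disjoint β γ L hγ hL with ⟨hV, hF⟩ | ⟨hV, -⟩ | ⟨-, hF⟩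
  · exact ⟨setOf_wind_ne_zero_subset_of_cells hγ hL hV hF, fun hsub ↦ absurd hγv (hsub hne)⟩
  · exact absurd hγv (hV _ hne)
  · exact absurd (hF _ (by rw [hγf]; norm_num)) hfL

/-- **Mesh-`δ` form for the closed-b.c. configuration `ω ∩ meshEdges U δ` of a bounded domain**:
a type-`0` interface loop is strictly enclosed (winding interiors at mesh `δ`) by an interface loop
of the same configuration visiting an edge of `meshEdges U δ`. -/
theorem exists_ssubset_of_loopType_eq_zero_mesh {U : Set ℂ} {δ : ℝ} (hδ : 0 < δ)
    (hU : Bornology.IsBounded U) {ω : BondConfig (Site 2)}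
    (hγ : IsInterfaceLoop (ω ∩ meshEdges U δ) γ) (ht : loopType γ = 0) :
    ∃ L : List MedialVertex, IsInterfaceLoop (ω ∩ meshEdges U δ) L ∧
      (∃ e ∈ L, e ∈ meshEdges U δ) ∧
      {z | (loopCurve δ 0 γ).wind z ≠ 0} ⊂ {z | (loopCurve δ 0 L).wind z ≠ 0} := by
  have hβ : ∀ x y, s(x, y) ∈ ω ∩ meshEdges U δ →
      x ∈ meshVertices U δ ∧ y ∈ meshVertices U δ :=
    fun x y h ↦ ⟨h.2 x (Sym2.mem_mk_left x y), h.2 y (Sym2.mem_mk_right x y)⟩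
  obtain ⟨L, hL, ⟨q, hq, hqo⟩, hss⟩ :=
    exists_ssubset_of_loopType_eq_zero (meshVertices_finite hU hδ) hβ hγ ht
  refine ⟨L, hL, ⟨cTgt q, List.mem_rotate.1 (List.of_mem_zip hq).2, hqo.2⟩, ?_⟩
  rw [setOf_wind_loopCurve_mesh hδ.ne' γ, setOf_wind_loopCurve_mesh hδ.ne' L]
  have hsurj : Surjective fun z : ℂ ↦ z / δ := fun w ↦
    ⟨w * δ, mul_div_cancel_right₀ w (Complex.ofReal_ne_zero.2 hδ.ne')⟩
  exact ⟨preimage_mono hss.1, fun h ↦ hss.2 (hsurj.preimage_subset_preimage_iff.1 h)⟩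

/-! ## The registered helper -/

/-- **The outermost loops of the closed-b.c. bond-`ℤ²` domain loop ensemble are all of type `1`**:
for `δ > 0` and bounded `U`, no type-`0` loop of `domLoopsZ2 U δ ω` is first generation — each is
strictly enclosed by the loop of the ensemble bounding, from outside, the open cluster of its rim
(registered helper `firstGen_domLoopsZ2_F_zero`, wave 2, toward `stub_kernelUniqueness` /
`stub_cascadeReconstruction`). -/
theorem firstGen_domLoopsZ2_F_zero : ∀ (U : Set ℂ) (δ : ℝ) (ω : BondConfig (Site 2)), 0 < δ → Bornology.IsBounded U → (firstGen (domLoopsZ2 U δ ω)).F 0 = ∅ := by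
  intro U δ ω hδ hU
  refine eq_empty_of_forall_notMem fun u hu ↦ ?_
  obtain ⟨⟨γ, hγ, ht, -, rfl⟩, hmax⟩ := hu
  obtain ⟨L, hL, hvis, hss⟩ := exists_ssubset_of_loopType_eq_zero_mesh hδ hU hγ ht
  exact hmax _ (LoopConfig.subset_loops _ (loopType L) ⟨L, hL, rfl, hvis, rfl⟩) hss

end Summit.CriticalPhenomena.CardyFormulaZ2.Cruxes.NestingRigidity.MarkovCascadeOneGeneration

end
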